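/-
Copyright (c) 2026. All rights reserved.
Released under Apache 2.0 license as described in the file LICENSE.
-/
import Literature.Probability.FitznerVanDerHofstad2017.NobleBoundsNMidS
import HarnessLib

/-!
# Fitzner–van der Hofstad (2017), §6.1 (6.4) / App. B: term-1 packages of a middle junction, variant `F‴`, cells `(a, 1, 0)`

[FvdH17] = R. Fitzner, R. van der Hofstad, *Generalized approach to the non-backtracking lace expansion*,
arXiv:1506.07977v2 (EJP 22 (2017), paper 43).  Page numbers refer to the arXiv version.

Continuation of `NobleBoundsNMidS` (cells `(a, 2, 0)`) and `NobleBoundsNMidSZero` (cells `(a, 0, 0)`): the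
packages of a MIDDLE junction `k` (`1 ≤ k ≤ M`) of variant `F‴` (kind `midS`, (4.61), p. 41) for the cells
`(a, c, a′) = (a, 1, 0)`, `a ∈ {1, 2}` — inner class `1`: the last sausage of level `k + 1` is a single OPEN bond,
`t_k ~ z_k`, `(t_k, z_k) ∈ ω_{k+1}` ([FvdH17] §6.1 "Case b = 1": "we include the information that z, t are
neighbors", p. 59), read witness-wise through the open-bond normal form `Conds.tzNF` of `NobleJointNLevel`
(the open bond IS the witness of its line, so the line is the letter `{t ←1̲→ z}`).  The target is the `c = 1`
summand `A^{κ,a,1,*}(u,w,t,z) · A^{1,0}(t,z,w′,u′)` of the first term of the pointwise (5.4) (p. 48):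

* letter `A^{κ,a,1,*}(u,w,t,z) = [2dD(w−u)] S*_{1̲,0,1̲,0}(v−u,t−u,z−u,w−u)` (App. B Table "A^{ι,a,b}", p. 75, rows
  `b = 1`, with `S ↦ S*`): the bond `{u ←1̲→ v}`, the exit line `{z ↔ w}` of level `k`, the entry line
  `{v ↔ t}` and the open sausage bond `{t ←1̲→ z}` of level `k + 1`;
* letter `A^{1,0}(t,z,w′,u′) = δ_{w′,u′} 2dD(z−t) 𝓑_{1,1}(w′−t, z−t)` (App. B Table "A^{a,b}", p. 74, row `a = 1,
  b = 0`): the lines `{t ←1→ w′}`, `{w′ ←1→ z}` of level `k + 1` (`t, z ≠ u′ = w′`, canonical clause of `F‴`).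

§A the App. B rows as letter inequalities; §B the open-bond normal form at a `midS` level; §C the packages
`nonempty_jPkg_midS_one_zero` (grouping `glMidS1` and events `midEv` of `NobleBoundsNMidS`).

Conventions: `d`-generic; nothing is cited as a fact; additive.  Junction `k = i.castSucc = i₀.succ`.
-/

noncomputable section

namespace Literature.Probability.FitznerVanDerHofstad2017

open Literature.Barriers.CriticalPhenomena Literature.Probability.Percolation
open Literature.Probability.LatticeModels Literature.Combinatorics.SimpleGraph _root_.SimpleGraph
open _root_.MeasureTheory
open Literature.Probability.FitznerVanDerHofstad2017.NobleBlocks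
open Literature.Probability.FitznerVanDerHofstad2017.NobleBlocks.LenIdx
open scoped ENNReal

variable {d : ℕ}

/-! ### A. The App. B rows `A^{ι,a,1,*}` (`a = 1, 2`) and `A^{1,0}` as letter inequalities -/

section Rows

variable (p : unitInterval)

/-- Row `a ≥ 2, b = 1` of the `A^{ι,a,b,*}` table: `A^{ι,2,1,*}(0,v,x,y) = S*_{1̲,0,1̲,0}(e,x,y,v)`.
[cite: FitznerVanDerHofstad2017, App. B Table "definition of A^{ι,a,b}(0,v,x,y)", row a ≥ 2, b = 1, and the sentence after it (arXiv:1506.07977v2 p. 75)] -/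
theorem blockAiotaSt₀_two_one (L : Letters d) (ι : Fin d × Bool) (v x y : Site d) :
    blockAiotaSt₀ L ι 2 1 v x y = L.Sst (eq 1) (ge 0) (eq 1) (ge 0) (stepVec ι) x y v := rfl

/-- Row `a = 1, b = 1` of the `A^{ι,a,b,*}` table: `A^{ι,1,1,*}(0,v,x,y) = 2dD(v) S*_{1̲,0,1̲,0}(e,x,y,v)`.
[cite: FitznerVanDerHofstad2017, App. B Table "definition of A^{ι,a,b}(0,v,x,y)", row a = 1, b = 1, and the sentence after it (arXiv:1506.07977v2 p. 75)] -/
theorem blockAiotaSt₀_one_one (L : Letters d) (ι : Fin d × Bool) (v x y : Site d) :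
    blockAiotaSt₀ L ι 1 1 v x y = twoDD v * L.Sst (eq 1) (ge 0) (eq 1) (ge 0) (stepVec ι) x y v := rfl

/-- **Row `(2,1)` of `A^{ι,a,b,*}` as a four-line letter on two levels**: the lines `{u ←1̲→ v}`, `{v ↔ t}`,
`{t ←1̲→ z}`, `{z ↔ w}` are bounded by `A^{ι,2,1,*}(u,w,t,z) = S*_{1̲,0,1̲,0}(v−u, t−u, z−u, w−u)`.
[cite: FitznerVanDerHofstad2017, §6.1 "Case a ≥ 2", "Case b = 1" (arXiv:1506.07977v2 p. 59); App. B (p. 75); §4.2 after (4.17) (p. 36)] -/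
theorem piPerc_midS_two_one_le_blockAiotaSt {ι : Fin d × Bool} {u v w t z : Site d} (hv : v = u + stepVec ι)
    (c : Fin 4 → Fin 2) :
    piPerc d p 2 (genDisjOcc ![event (eq 1) u v, event (ge 0) v t, event (eq 1) t z, event (ge 0) z w] c) ≤
      blockAiotaSt (Letters.perc d p) ι 2 1 u w t z := by
  have he : v - u = stepVec ι := by rw [hv, add_sub_cancel_left]
  rw [blockAiotaSt, ofBase, blockAiotaSt₀_two_one, ← he]
  exact (piPerc_genDisjOcc_le_S p (eq 1) (ge 0) (eq 1) (ge 0) u v t z w c).trans (perc_S_le_Sst p _ _ _ _ _ _ _ _)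

/-- **Row `(1,1)` of `A^{ι,a,b,*}` as a four-line letter on two levels**: for `w` a lattice neighbour of `u` the
same four lines are bounded by `A^{ι,1,1,*}(u,w,t,z)`.
[cite: FitznerVanDerHofstad2017, §6.1 "Case a = 1", "Case b = 1" (arXiv:1506.07977v2 p. 59); App. B (p. 75); §4.2 after (4.17) (p. 36)] -/
theorem piPerc_midS_one_one_le_blockAiotaSt {ι κ' : Fin d × Bool} {u v w t z : Site d} (hv : v = u + stepVec ι)
    (hw : w = u + stepVec κ') (c : Fin 4 → Fin 2) :
    piPerc d p 2 (genDisjOcc ![event (eq 1) u v, event (ge 0) v t, event (eq 1) t z, event (ge 0) z w] c) ≤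
      blockAiotaSt (Letters.perc d p) ι 1 1 u w t z := by
  have he : v - u = stepVec ι := by rw [hv, add_sub_cancel_left]
  have hk : w - u = stepVec κ' := by rw [hw, add_sub_cancel_left]
  rw [blockAiotaSt, ofBase, blockAiotaSt₀_one_one, hk, twoDD_stepVec, one_mul, ← hk, ← he]
  exact (piPerc_genDisjOcc_le_S p (eq 1) (ge 0) (eq 1) (ge 0) u v t z w c).trans (perc_S_le_Sst p _ _ _ _ _ _ _ _)

/-- **Row `(1,0)` of `A^{a,b}` as a two-line letter**: for `z` a lattice neighbour of `t` (`2dD(z−t) = 1`) the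
lines `{t ←1→ w′}`, `{w′ ←1→ z}` on one level are bounded by `A^{1,0}(t,z,w′,w′) = 𝓑_{1,1}(w′−t, z−t)`.
[cite: FitznerVanDerHofstad2017, App. B Table "definition of A^{a,b}(0,v,x,y)", row a = 1, b = 0 (arXiv:1506.07977v2 p. 74); §4.2 (4.16) (p. 36)] -/
theorem piPerc_midS_one_zero_le_blockA {κ' : Fin d × Bool} {t z w' : Site d} (hz : z = t + stepVec κ')
    (c : Fin 2 → Fin 2) :
    piPerc d p 2 (genDisjOcc ![event (ge 1) t w', event (ge 1) w' z] c) ≤ blockA (Letters.perc d p) 1 0 t z w' w' := by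
  have hk : z - t = stepVec κ' := by rw [hz, add_sub_cancel_left]
  rw [blockA, ofBase, blockA₀_one_zero, kd_self, one_mul, hk, twoDD_stepVec, one_mul, ← hk]
  exact piPerc_genDisjOcc_le_B p (ge 1) (ge 1) t w' z c

end Rows

/-! ### B. The open-bond normal form of the sausage line at a `midS` level -/

section MidSFacts

variable {M : ℕ} {x : Site d} {b : Fin (M + 2) → Site d × Site d} {w t z : Fin (M + 2) → Site d}
  {a : Fin (M + 2) → Fin 3 ⊕ Unit} {c : Fin 3 ⊕ Unit} {τ : Fin (M + 1) → Bool × Fin 3}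
  {ω : Fin (M + 3) → BondConfig (Site d)} {K₀ : Fin (M + 3) → Fin 6 → Set (Sym2 (Site d))}

/-- **The open sausage bond is its own witness** on a `midS` level `k + 1`: if `t_k ≠ z_k` and `(t_k, z_k)` is open
in `ω_{k+1}`, the witness of the sausage line (slot `1`) is `{(t_k, z_k)}`.
[cite: FitznerVanDerHofstad2017, §6.1 proof of Lemma 5.2, Case b = 1, "we include the information that … z, t are neighbors" (arXiv:1506.07977v2 p. 59); §4.4 after (4.65) (p. 43)] -/
theorem JFacts.tz_witness_midS (h : JFacts M x b w t z a c τ ω K₀) (i : Fin (M + 1)) (hσ : (τ i).1 = false)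
    {a' : Fin 3} (ha' : a i.succ = Sum.inl a') (htz : t i.castSucc ≠ z i.castSucc)
    (hb : s(t i.castSucc, z i.castSucc) ∈ ω i.castSucc.succ) :
    K₀ i.castSucc.succ 1 = {s(t i.castSucc, z i.castSucc)} := by
  have h9 := h.conds.tzNF i.castSucc.succ
  rw [pieceViews_midS M x b w t z a τ i hσ ha'] at h9
  exact h9 (fun h => by cases h) htz hb

end MidSFacts

/-! ### C. The packages of the cells `(a, 1, 0)`, `a ∈ {1, 2}`, variant `F‴` -/

section Packages

variable (p : unitInterval) (M : ℕ) (x : Site d) (b : Fin (M + 2) → Site d × Site d) (w t z : Fin (M + 2) → Site d)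
  (a : Fin (M + 2) → Fin 3 ⊕ Unit) (c : Fin 3 ⊕ Unit) (τ : Fin (M + 1) → Bool × Fin 3)

/-- **Cells `(a, 1, 0)`, `a ∈ {1,2}`, variant `F‴`, of a middle junction `k = i₀ + 1 ≤ M`** (`1 ≤ k`): a package
with target the `c = 1` summand `A^{κ,a,1,*}(u_k,w_k,t_k,z_k) · A^{1,0}(t_k,z_k,w_{k+1},u_{k+1})` of the first
term of (5.4).  Inner class `1` makes the sausage line of level `k + 1` the open bond `{t ←1̲→ z}` itself
(`Conds.tzNF`) and `z ~ t` (`2dD(z−t) = 1`); exit class `0` above identifies `w_{k+1} = u_{k+1}`, so that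
`{t ←1→ w_{k+1}}`, `{w_{k+1} ←1→ z}` (`t, z ≠ u_{k+1}`, canonical clause of `F‴`).  (`a = 0` with `b = 1` is a
two-term row of a different shape and is not treated here.)
[cite: FitznerVanDerHofstad2017, §6.1 (6.4), "Case a = 1 / a ≥ 2", "Case b = 1" (arXiv:1506.07977v2 pp. 58–59); §5.1 (5.4) (p. 48); App. B (pp. 74–75)] -/
theorem nonempty_jPkg_midS_one_zero (i i₀ : Fin (M + 1)) (hk : i₀.succ = i.castSucc) (κ : Fin d × Bool)
    (hb : (b i.castSucc).2 = (b i.castSucc).1 + stepVec κ) (hσ : (τ i).1 = false) (hc1 : (τ i).2 = 1)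
    (a₀ : Fin 3) (ha : a i.castSucc = Sum.inl a₀) (ha0 : a₀ ≠ 0) (ha' : a i.succ = Sum.inl 0) :
    Nonempty (JPkg p (jctx M x b w t z a τ i.castSucc) (JFacts M x b w t z a c τ)
      (blockAiotaSt (Letters.perc d p) κ a₀ 1 (b i.castSucc).1 (w i.castSucc) (t i.castSucc) (z i.castSucc) *
        blockA (Letters.perc d p) 1 0 (t i.castSucc) (z i.castSucc) (w i.succ) (b i.succ).1)) := by
  -- degenerate parameters: the piece is empty
  by_cases hP : (zdGraph d).Adj (t i.castSucc) (z i.castSucc) ∧ w i.succ = (b i.succ).1 ∧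
      t i.castSucc ≠ (b i.succ).1 ∧ z i.castSucc ≠ (b i.succ).1 ∧
      (a₀ = 1 → (zdGraph d).Adj (b i.castSucc).1 (w i.castSucc))
  swap
  · refine ⟨JPkg.vacuous p _ _ (fun ω K₀ hF => hP ?_) _⟩
    exact ⟨(hF.innerClass_one i hc1).2.2, hF.w_eq_of_exitClass_zero i.succ ha', (hF.canon_midS i hσ ha').2,
      (hF.canon_midS i hσ ha').1, fun h1 => (hF.exitClass_one i.castSucc (ha.trans (by rw [h1]))).2.2⟩
  obtain ⟨hadj, hwy, hty, hzy, hw1⟩ := hP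
  have htz : t i.castSucc ≠ z i.castSucc := hadj.ne
  obtain ⟨κ', hκ'⟩ := (zdGraph_adj_iff_stepVec _ _).1 hadj
  have huv : (b i.castSucc).1 ≠ (b i.castSucc).2 := by
    rw [hb]; exact (zdGraph_adj_iff_stepVec _ _ |>.2 ⟨κ, rfl⟩).ne
  rw [hwy]
  refine nonempty_jPkg_of_joint p i.castSucc glMidS1 true
    (midEv (event (eq 1) (b i.castSucc).1 (b i.castSucc).2) (event (ge 0) (b i.castSucc).2 (t i.castSucc))
      (event (eq 1) (t i.castSucc) (z i.castSucc)) (event (ge 1) (t i.castSucc) (b i.succ).1)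
      (event (ge 1) (b i.succ).1 (z i.castSucc)) Set.univ (event (ge 0) (z i.castSucc) (w i.castSucc)))
    (isFinitary_midEv _ _ _ _ _ _ _ (isFinitary_event _ _ _) (isFinitary_event _ _ _) (isFinitary_event _ _ _)
      (isFinitary_event _ _ _) (isFinitary_event _ _ _) isFinitary_univ (isFinitary_event _ _ _))
    (fun _ => by rw [midEv_xb]; exact singleton_mem_event_eq_one huv)
    (fun j j' _ _ hg => glMidS1_entry M x b w t z a τ i hσ ha' j j' hg)
    (fun ω K₀ hF => ⟨fun j hj => ?_, fun j hj => ?_⟩) ?_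
  · -- the exit witness of level `k`
    obtain rfl := (jMidOpen_act_lo_iff M x b w t z a τ i i₀ hk ha true false j).1 hj
    rw [midEv_lo_five, event_comm, event_ge]
    exact mem_openConnGe_zero_of_mem (hF.conn_exit i i₀ hk ha)
  · -- the witnesses of level `k + 1`: the sausage witness is the open bond itself
    have hj5 : j ≠ 5 := (jMidS_act_up_iff M x b w t z a τ i hσ ha' true false j).1 hj
    obtain ⟨h0, -, h2, h3, -⟩ := hF.conn_midS i hσ ha'
    rw [hwy] at h2
    have hK := hF.tz_witness_midS i hσ ha' htz (hF.innerClass_one i hc1).2.1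
    refine mem_midEv_up _ _ _ _ _ _ _ ?_ ?_ ?_ ?_ (Set.mem_univ _) j hj5
    · rw [event_ge]; exact mem_openConnGe_zero_of_mem h0
    · rw [hK]; exact singleton_mem_event_eq_one htz
    · rw [event_ge]; exact mem_openConnGe_one_of_ne h2 hty
    · rw [event_comm, event_ge]; exact mem_openConnGe_one_of_ne h3 hzy
  · -- the two letters
    refine (prod_junF_le₂ p M x b w t z a τ i.castSucc glMidS1 true false _
      (show JIdx.xb ≠ JIdx.up 2 by decide)).trans (mul_le_mul' ?_ ?_)
    · -- `A^{κ,a,1,*}`: bond, `v → t`, the open sausage bond, exit of level `k`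
      refine (junF_le_of_lines p M x b w t z a τ i.castSucc glMidS1 true false _ JIdx.xb
        ![JIdx.xb, .up 0, .up 1, .lo 5] (by decide) (fun m => ?_) ![0, 1, 1, 0] (fun m => by fin_cases m <;> rfl)
        ![event (eq 1) (b i.castSucc).1 (b i.castSucc).2, event (ge 0) (b i.castSucc).2 (t i.castSucc),
          event (eq 1) (t i.castSucc) (z i.castSucc), event (ge 0) (z i.castSucc) (w i.castSucc)]
        (by funext m; fin_cases m <;> rfl)).trans ?_
      · fin_cases m
        · exact ⟨rfl, rfl⟩
        · exact ⟨(jMidS_act_up_iff M x b w t z a τ i hσ ha' true false 0).2 (by decide), rfl⟩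
        · exact ⟨(jMidS_act_up_iff M x b w t z a τ i hσ ha' true false 1).2 (by decide), rfl⟩
        · exact ⟨(jMidOpen_act_lo_iff M x b w t z a τ i i₀ hk ha true false 5).2 rfl, rfl⟩
      · obtain h1 | h2 : a₀ = 1 ∨ a₀ = 2 := by
          fin_cases a₀
          · exact absurd rfl ha0
          · exact Or.inl rfl
          · exact Or.inr rfl
        · subst h1
          obtain ⟨κ'', hκ''⟩ := (zdGraph_adj_iff_stepVec _ _).1 (hw1 rfl)
          exact piPerc_midS_one_one_le_blockAiotaSt p hb hκ'' _
        · subst h2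
          exact piPerc_midS_two_one_le_blockAiotaSt p hb _
    · -- `A^{1,0}`: `t → w′`, `w′ → z` on level `k + 1`, `z ~ t`
      refine (junF_le_of_lines p M x b w t z a τ i.castSucc glMidS1 true false _ (JIdx.up 2)
        ![JIdx.up 2, .up 3] (by decide) (fun m => ?_) ![1, 1] (fun m => by fin_cases m <;> rfl)
        ![event (ge 1) (t i.castSucc) (b i.succ).1, event (ge 1) (b i.succ).1 (z i.castSucc)]
        (by funext m; fin_cases m <;> rfl)).trans ?_
      · fin_cases m
        · exact ⟨(jMidS_act_up_iff M x b w t z a τ i hσ ha' true false 2).2 (by decide), rfl⟩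
        · exact ⟨(jMidS_act_up_iff M x b w t z a τ i hσ ha' true false 3).2 (by decide), rfl⟩
      · exact piPerc_midS_one_zero_le_blockA p hκ' _

end Packages

end Literature.Probability.FitznerVanDerHofstad2017

end
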